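import Summits.QuantumFields.YangMills.Theorems.FlatTubeReductionNearRegionOfInnerRatePrelim
import HarnessLib

/-!
# Route `FlatTubeReduction` (K1 `NearFlatRatioLaw` 24720, K1a′ 27141; pool `FixedLatticeLaw` 23943): the NEAR-REGION TUBE RATIO LAW for states
# `ψ ⊥ Ω` from the INNER NO-INTRUDER WITH RATE (the conclusion of the Born–Oppenheimer door `innerRateAt_of_bo_pow 1`) and the CONCENTRATION
# of the exact ground state (rung R2b1 = RECORD-label femto gap; no summit statement is proved here)

Seat `ym-line-ftr-p1` g4 (prover).  The K1 side of the FlatTubeReduction line asks a ratio law for EVERY tube state `ψ ⊥ Ω` supported in RED's near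
region `⋃_z {orbitDist (τ_z U) < β^{−p}}` (hypothesis `hA` of `nearFlatRatioLaw_of_nearRegionTubeRatioLaw`, p619200), whereas the FixedLatticeLaw door
(`FemtoCutoffLadder.innerRateAt_of_bo_pow`, p599058; stub `stub_boRate` of crux 23943) delivers the MIN–MAX form: every physical 2-family supported in the
inner region `{∃ z, orbitDist (τ_z U) < β^{−1/40}}` has a combination obeying the bound.  This file closes the gap between the two: apply the min–max form
to the family `(cos Θ_{6ρ}·Ω, ψ)` (`ρ = β^{−1/39}`), where the inner cut-off of the exact ground state is admissible because the ground state CONCENTRATES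
(`‖sin Θ_{3ρ}Ω‖² ≤ ‖Ω‖²/β`, `GroundConc.groundState_outer_mass_le`, taken here as the hypothesis `hconc`), its Rayleigh quotient is `≥ (1 − 2/β)λ₀`, and
its transfer-form pairing with `ψ` is stretched-exponentially small (kernel locality across the gap `[β^{−1/38}, 3ρ]`); the two-case argument
`quad_endgame` on the size of `e^{Cu²}μ₁λ₀/μ₀` against `λ₀` then isolates `ψ`.
★★ `nearRegionTubeRatioLawAt_of_innerRate` — for `L ≥ 2`: INNER RATE (k = 1, δ = β^{−1/40}) + CONCENTRATION ⟹ the near-region tube ratio law at `p = 1/38`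
with constant `(C+1)/L`, VERBATIM the `L`-clause of `hA`.
HONEST FRAMING: glue over landed estimates; the inner rate (= Born–Oppenheimer data with rate, FixedLatticeLaw pool) stays OPEN; nothing here is infinite
volume, a continuum limit or the Clay mass gap.  No definitions, no named facts, no `sorry`.
References: M. Lüscher, NPB 219 (1983) 233 [cite: Luscher1983, §3]; Reed–Simon IV [cite: ReedSimonIV1978, Thm. XIII.1]; B. Simon, Ann. Phys. 146 (1983) 209
[cite: SimonB1983DiscreteSpectrum, §3].
-/

set_option autoImplicit false

noncomputable section

open MeasureTheory Filter Topology Real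
open scoped Matrix BigOperators
open Literature.MathematicalPhysics.QuantumFieldTheory hiding SU2
open Literature.MathematicalPhysics.QuantumLattice

namespace Summit.QuantumFields.YangMills.Theorems.FemtoTransferGap

namespace GroundConc

open Summit.QuantumFields.YangMills.Theorems.FemtoTransferGap.OffTube
open Summit.QuantumFields.YangMills.Theorems.FemtoCutoffLadder

variable {L : ℕ} [NeZero L]
/-! ## §4 The near-region tube ratio law from the inner rate and the concentration -/

/-- ★★ **NEAR-REGION TUBE RATIO LAW from the INNER NO-INTRUDER WITH RATE** (`L ≥ 2`).  Hypotheses: `hI` = the conclusion of the Born–Oppenheimer door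
`FemtoCutoffLadder.innerRateAt_of_bo_pow 1` at `δ = β^{−1/40}` (every physical 2-family in the inner region with nondegenerate Gram matrix has a combination with
`⟨ψ,Kψ⟩μ₀ ≤ e^{Cλ_b(L³β)²}μ₁λ₀‖ψ‖²`); `hconc` = the concentration of the exact ground state (`‖sin Θ_{3ρ}Ω‖² ≤ ‖Ω‖²/β`, `ρ = β^{−1/39}`,
`groundState_outer_mass_le`).  Conclusion: VERBATIM the `L`-clause of the hypothesis `hA` of `nearFlatRatioLaw_of_nearRegionTubeRatioLaw` with `θ = 1/2`,
`p = 1/38`, `C' = (C+1)/L`: every physical `ψ ⊥ Ω` supported in `{∃ z, orbitDist (τ_z U) < β^{−1/38}}` has `⟨ψ,Kψ⟩μ₀ ≤ e^{C'λ_b²/L}μ₁λ₀‖ψ‖²`.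
Proof: the door on the family `(cos Θ_{6ρ}Ω, ψ)` (`innerCut_facts`), locality of the cross term (`abs_qform_le_crossBound_of_sep` across `[β^{−1/38}, 3ρ]`),
crux ONE's lower one-site law (`oneSiteLevels_proof 1`), then `quad_endgame`. [cite: Luscher1983, §3] [cite: ReedSimonIV1978, Thm. XIII.1] -/
theorem nearRegionTubeRatioLawAt_of_innerRate (hL : 2 ≤ L)
    (hI : ∃ C βI : ℝ, ∀ β : ℝ, βI ≤ β →
      ∀ F : Fin 2 → (GaugeConfig 3 L SU2 → ℝ), (∀ i, IsPhys (F i)) →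
        (∀ i U, F i U ≠ 0 → ∃ z : Fin 3 → Bool, orbitDist (TT.twist3 z U) < powScale (1 / 40) β) →
        (∀ a : Fin 2 → ℝ, a ≠ 0 → 0 < l2 (fun U => ∑ i, a i * F i U) (fun U => ∑ i, a i * F i U)) →
          ∃ a : Fin 2 → ℝ, a ≠ 0 ∧
            qform su2Rep β (fun U => ∑ i, a i * F i U) (fun U => ∑ i, a i * F i U) * levelValue su2Rep 1 ((L : ℝ) ^ 3 * β) 0 ≤
              Real.exp (C * bareLambda ((L : ℝ) ^ 3 * β) ^ 2) * levelValue su2Rep 1 ((L : ℝ) ^ 3 * β) 1 *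
                levelValue su2Rep L β 0 * l2 (fun U => ∑ i, a i * F i U) (fun U => ∑ i, a i * F i U))
    (hconc : ∃ βc : ℝ, ∀ β : ℝ, βc ≤ β → ∀ Ω : GaugeConfig 3 L SU2 → ℝ, IsPhys Ω →
      transferApply β Ω = topValue su2Rep L β • Ω →
      l2 (fun U => Real.sin (innerPhase (3 * powScale (1 / 39) β) U) * Ω U)
          (fun U => Real.sin (innerPhase (3 * powScale (1 / 39) β) U) * Ω U) ≤ l2 Ω Ω / β) :
    ∃ θ p C β0 : ℝ, 0 < θ ∧ θ < 1 ∧ (0 < p ∧ p < 1 / 17) ∧ ∀ β : ℝ, β0 ≤ β →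
      ∀ (Ω ψ : GaugeConfig 3 L SU2 → ℝ), IsPhys Ω → (∀ U, 0 < Ω U) → transferApply β Ω = topValue su2Rep L β • Ω → IsPhys ψ →
      l2 ψ Ω = 0 → (∀ U, β ^ (-θ) < wilsonAction su2Rep U → ψ U = 0) →
      (∀ U, ψ U ≠ 0 → ∃ z : Fin 3 → Bool, orbitDist (TT.twist3 z U) < powScale p β) →
      qform su2Rep β ψ ψ * levelValue su2Rep 1 ((L : ℝ) ^ 3 * β) 0 ≤
        Real.exp (C * bareLambda β ^ 2 / L) * levelValue su2Rep 1 ((L : ℝ) ^ 3 * β) 1 * topValue su2Rep L β * l2 ψ ψ := by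
  have hL0 : (0 : ℝ) < L := by exact_mod_cast Nat.pos_of_ne_zero (NeZero.ne L)
  have hL3 : (8 : ℝ) ≤ (L : ℝ) ^ 3 := by
    have h2 : (2 : ℝ) ≤ L := by exact_mod_cast hL
    have h := pow_le_pow_left₀ (by norm_num : (0 : ℝ) ≤ 2) h2 3
    norm_num at h
    exact h
  set n : ℕ := Fintype.card (Edge 3 L) with hn
  have hn0 : (0 : ℝ) < n := by rw [hn]; exact_mod_cast Fintype.card_pos
  set f : ℝ := uniformFloorConst L with hf
  have hf0 : 0 < f := uniformFloorConst_pos (L := L)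
  set w : ℝ := Real.exp (-(1 / 2 : ℝ)) * (8 / (3 * π ^ 3)) with hw
  have hw0 : 0 < w := by positivity
  set cL : ℝ := (2 / (L : ℝ) ^ 3) ^ ((1 : ℝ) / 3) with hcL
  have hcL0 : 0 < cL := by positivity
  obtain ⟨C, βI, hI'⟩ := hI
  obtain ⟨βc, hc'⟩ := hconc
  obtain ⟨C₁, B0, hONE⟩ := oneSiteLevels_proof 1
  -- thresholds
  have hτ0 : 0 < 1 / (|C| + |C₁| + |levelGap 1| + 1) := by positivity
  obtain ⟨β1, h1⟩ := superpoly_small (8 / (f * cL ^ 2) * (4 / w) ^ n) (2 * n + 1) (c := 2 / n) (s := 37 / 39) (ε := 1)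
    (by positivity) (by norm_num) one_pos
  obtain ⟨β2, h2⟩ := eventually_rpow_dominates (a := 1 / 1560) (b := 0) (k := 0) (C := 2) (by norm_num) (by norm_num)
  refine ⟨1 / 2, 1 / 38, (C + 1) / L, max (max βI βc) (max (max B0 (2 / (1 / (|C| + |C₁| + |levelGap 1| + 1)) ^ 3))
    (max (max β1 β2) (128 * (L : ℝ) ^ 6))), by norm_num, by norm_num, ⟨by norm_num, by norm_num⟩, ?_⟩
  intro β hβ Ω ψ hΩ hΩpos heig hψ hψΩ _hψT hψs
  have hβI : βI ≤ β := ((le_max_left _ _).trans (le_max_left _ _)).trans hβ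
  have hβc : βc ≤ β := ((le_max_right _ _).trans (le_max_left _ _)).trans hβ
  have hβB0 : B0 ≤ β := (((le_max_left _ _).trans (le_max_left _ _)).trans (le_max_right _ _)).trans hβ
  have hβτ : 2 / (1 / (|C| + |C₁| + |levelGap 1| + 1)) ^ 3 ≤ β :=
    (((le_max_right _ _).trans (le_max_left _ _)).trans (le_max_right _ _)).trans hβ
  obtain ⟨hβ1, h1β⟩ := h1 β ((((le_max_left _ _).trans (le_max_left _ _)).trans (le_max_right _ _)).trans ((le_max_right _ _).trans hβ))
  obtain ⟨-, h2β⟩ := h2 β ((((le_max_right _ _).trans (le_max_left _ _)).trans (le_max_right _ _)).trans ((le_max_right _ _).trans hβ))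
  have hβL : 128 * (L : ℝ) ^ 6 ≤ β := ((le_max_right _ _).trans (le_max_right _ _)).trans ((le_max_right _ _).trans hβ)
  clear h1 h2
  simp only [zero_mul, add_zero, Real.rpow_zero, mul_one] at h2β
  have hβ0 : 0 < β := by linarith
  have hββ : ∀ x : ℝ, β * β ^ x = β ^ (1 + x) := fun x => by rw [Real.rpow_add hβ0, Real.rpow_one]
  -- scales
  set ρ : ℝ := powScale (1 / 39) β with hρdef
  have hρ : ρ = β ^ (-(1 / 39 : ℝ)) := powScale_eq hβ1
  have hρ0 : 0 < ρ := powScale_pos _ _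
  have hp38 : powScale (1 / 38) β ≤ ρ := by
    rw [hρ, powScale_eq hβ1]
    exact Real.rpow_le_rpow_of_exponent_le hβ1 (by norm_num)
  have hp40 : ρ ≤ powScale (1 / 40) β := by
    rw [hρ, powScale_eq hβ1]
    exact Real.rpow_le_rpow_of_exponent_le hβ1 (by norm_num)
  have h6ρ : 6 * ρ ≤ powScale (1 / 40) β := by
    rw [hρ, powScale_eq hβ1]
    have e : β ^ (-(1 / 40 : ℝ)) = β ^ ((1 : ℝ) / 1560) * β ^ (-(1 / 39 : ℝ)) := by
      rw [← Real.rpow_add hβ0]; norm_num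
    rw [e]
    exact mul_le_mul_of_nonneg_right (by linarith only [h2β]) (Real.rpow_nonneg hβ0.le _)
  -- `u = λ_b(L³β)`, the one-site levels at `B = L³β`
  set u : ℝ := bareLambda ((L : ℝ) ^ 3 * β) with hudef
  have hBβ : β ≤ (L : ℝ) ^ 3 * β := by
    have h1 : (1 : ℝ) * β ≤ (L : ℝ) ^ 3 * β := mul_le_mul_of_nonneg_right (by linarith only [hL3]) hβ0.le
    linarith only [h1]
  have hB2 : 2 ≤ (L : ℝ) ^ 3 * β := by
    have h1 : (8 : ℝ) * 1 ≤ (L : ℝ) ^ 3 * β := mul_le_mul hL3 hβ1 zero_le_one (by positivity)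
    linarith only [h1]
  have hB0' : 0 < (L : ℝ) ^ 3 * β := by positivity
  have hu01 := bareLambda_pos_le_one hB2
  have hu0 : 0 < u := hu01.1
  have hu1 : u ≤ 1 := hu01.2
  have hu : u = cL * β ^ (-(1 : ℝ) / 3) := bareLambda_cube_eq (L := L) hβ0
  have huL : u = bareLambda β / L := bareLambda_cube_mul hβ0 L
  have hu3 : u ^ 3 = 2 / ((L : ℝ) ^ 3 * β) := bareLambda_pow_three_eq hB0'
  have huτ : u ≤ 1 / (|C| + |C₁| + |levelGap 1| + 1) := bareLambda_cube_le (L := L) hτ0 hβτ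
  obtain ⟨hμ0, -, hμ1⟩ := hONE ((L : ℝ) ^ 3 * β) (hβB0.trans hBβ)
  set μ0 := levelValue su2Rep 1 ((L : ℝ) ^ 3 * β) 0 with hμ0def
  set μ1 := levelValue su2Rep 1 ((L : ℝ) ^ 3 * β) 1 with hμ1def
  set lam := topValue su2Rep L β with hlam
  have hlam0 : 0 < lam := topValue_su2Rep_pos L β
  have hlat0 : 0 < latCE L β := latCE_pos (L := L) hβ0.le
  have hlamf : f * latCE L β ≤ lam := by
    have h := levelValue_zero_ge_uniform (L := L) hβ1
    rwa [levelValue_zero] at h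
  -- `E = e^{Cu²} μ₁ λ₀ / μ₀ ≥ λ₀/4`
  set E : ℝ := Real.exp (C * u ^ 2) * μ1 * lam / μ0 with hEdef
  have hexpE : 1 / 4 ≤ Real.exp (C * u ^ 2) * Real.exp (-(levelGap 1 * u + C₁ * u ^ 2)) := quarter_le_exp_mul_exp hu0 huτ
  have hE : lam / 4 ≤ E := by
    rw [hEdef, le_div_iff₀ hμ0]
    have h1 : Real.exp (C * u ^ 2) * (Real.exp (-(levelGap 1 * u + C₁ * u ^ 2)) * μ0) ≤ Real.exp (C * u ^ 2) * μ1 :=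
      mul_le_mul_of_nonneg_left hμ1 (Real.exp_pos _).le
    have h2 := mul_le_mul_of_nonneg_right hexpE (mul_nonneg hμ0.le hlam0.le)
    have h3 := mul_le_mul_of_nonneg_right h1 hlam0.le
    calc lam / 4 * μ0 = 1 / 4 * (μ0 * lam) := by ring
      _ ≤ Real.exp (C * u ^ 2) * Real.exp (-(levelGap 1 * u + C₁ * u ^ 2)) * (μ0 * lam) := h2
      _ = Real.exp (C * u ^ 2) * (Real.exp (-(levelGap 1 * u + C₁ * u ^ 2)) * μ0) * lam := by ring
      _ ≤ Real.exp (C * u ^ 2) * μ1 * lam := h3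
  -- `8/β ≤ u²`
  have hm : 8 * (1 / β) ≤ u ^ 2 :=
    eight_div_le_sq (A := (L : ℝ) ^ 3) hu0 (by positivity) hβ0 hu3 (by
      have e : ((L : ℝ) ^ 3) ^ 2 = (L : ℝ) ^ 6 := by ring
      rw [e]; exact hβL)
  -- the cross-copy bound at separation `2ρ`: `cb ≤ (u²/8)·f·c_β^{|E|} ≤ (u²/8)λ₀`
  set cb : ℝ := crossBound L β (2 * ρ) with hcbdef
  have hcb0 : 0 ≤ cb := (crossBound_pos (L := L) β (2 * ρ)).le
  have hcb : cb ≤ u ^ 2 / 8 * lam := by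
    have h := crossBound_le_poly_latCE (L := L) hβ1 (2 * ρ)
    rw [← hn, ← hw] at h
    exact (cb_small_real n hβ1 hn0 hf0 hcL0 hw0 hlat0.le hu hρ h h1β).trans (mul_le_mul_of_nonneg_left hlamf (by positivity))
  -- the trivial case `‖ψ‖² = 0`
  rcases (l2_self_nonneg ψ).eq_or_lt with hn0 | hnpos
  · have hQ := qform_le_topValue_mul_l2 hβ0.le hψ
    rw [← hn0, mul_zero] at hQ
    rw [← hn0, mul_zero]
    exact mul_nonpos_of_nonpos_of_nonneg hQ hμ0.le
  -- the inner cut-off of `Ω` and the concentration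
  have hM := hc' β hβc Ω hΩ heig
  obtain ⟨hΩin, hD, hsum, hlDD, hlDΩ, hnle, hnge, hQ0, hDsupp, hΩinsupp⟩ := innerCut_facts hβ0.le hρ0 hΩ heig hM
  set Ωin : GaugeConfig 3 L SU2 → ℝ := fun U => Real.cos (innerPhase (6 * ρ) U) * Ω U with hΩindef
  set D : GaugeConfig 3 L SU2 → ℝ := fun U => (1 - Real.cos (innerPhase (6 * ρ) U)) * Ω U with hDdef
  set N : ℝ := l2 Ω Ω with hNdef
  have hNpos : 0 < N := by
    rw [hNdef]; unfold l2
    have hint : Integrable (fun U => Ω U * Ω U) (configMeasure SU2 L) := hΩ.integrable_mul hΩ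
    have hnn : 0 ≤ᵐ[configMeasure SU2 L] fun U => Ω U * Ω U := ae_of_all _ fun U => mul_self_nonneg _
    rw [integral_pos_iff_support_of_nonneg_ae hnn hint]
    have hsupp : Function.support (fun U => Ω U * Ω U) = Set.univ := by
      ext U; simp [(hΩpos U).ne']
    rw [hsupp, measure_univ]; exact one_pos
  -- `ψ` sits where `cos Θ_{6ρ} = 1`, far from `supp D`
  have hψρ : ∀ U, ψ U ≠ 0 → ∃ z : Fin 3 → Bool, orbitDist (TT.twist3 z U) < ρ := fun U hU => by
    obtain ⟨z, hz⟩ := hψs U hU; exact ⟨z, hz.trans_le hp38⟩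
  have hΩinψ : ∀ U, Ωin U * ψ U = Ω U * ψ U := by
    intro U
    by_cases hU : ψ U = 0
    · rw [hU, mul_zero, mul_zero]
    · obtain ⟨z, hz⟩ := hψρ U hU
      have hcos : Real.cos (innerPhase (6 * ρ) U) = 1 := cos_innerPhase_eq_one (by positivity) ⟨z, by linarith only [hz, hρ0]⟩
      simp only [hΩindef, hcos, one_mul]
  have hlΩinψ : l2 Ωin ψ = 0 := by
    have h1 : l2 Ωin ψ = l2 Ω ψ := by unfold l2; exact integral_congr_ae (ae_of_all _ fun U => hΩinψ U)
    rw [h1, l2_comm, hψΩ]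
  have hsep : ∀ (s t : ℝ) (U V : GaugeConfig 3 L SU2), (s • ψ) U ≠ 0 → (t • D) V ≠ 0 →
      2 * ρ ≤ ∑ e : Edge 3 L, frobNorm (((U e : SU2) : Matrix (Fin 2) (Fin 2) ℂ) - ((V e : SU2) : Matrix (Fin 2) (Fin 2) ℂ)) := by
    intro s t U V hU hV
    have hU' : ψ U ≠ 0 := fun h0 => hU (by rw [Pi.smul_apply, smul_eq_mul, h0, mul_zero])
    have hV' : D V ≠ 0 := fun h0 => hV (by rw [Pi.smul_apply, smul_eq_mul, h0, mul_zero])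
    obtain ⟨z, hz⟩ := hψρ U hU'
    have hVz := hDsupp V hV' z
    have h := abs_orbitDist_twist3_sub_le z U V
    rw [abs_le] at h
    linarith only [h.1, hz, hVz]
  -- the cross term `X = ⟨Ω_in, Kψ⟩ = −⟨ψ, K D⟩`
  obtain ⟨CΩin, hCΩin⟩ := hΩin.bounded
  obtain ⟨Cψ, hCψ⟩ := hψ.bounded
  have hXeq : qform su2Rep β Ωin ψ = -qform su2Rep β ψ D := by
    have h1 : qform su2Rep β Ωin ψ = qform su2Rep β ψ Ωin := FemtoCutoffLadder.qform_comm_bdd hΩin.measurable hCΩin hψ.measurable hCψ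
    have h2 : qform su2Rep β ψ Ω = qform su2Rep β ψ Ωin + qform su2Rep β ψ D := by
      conv_lhs => rw [hsum]
      exact OffTube.qform_add_right β hψ hΩin hD
    have h3 : qform su2Rep β ψ Ω = lam * l2 ψ Ω := qform_eigen_right β heig ψ
    rw [hψΩ, mul_zero] at h3
    linarith only [h1, h2, h3]
  have hX : ∀ a₀ a₁ : ℝ, 2 * |a₀ * a₁ * qform su2Rep β Ωin ψ| ≤ cb * (a₁ ^ 2 * l2 ψ ψ + a₀ ^ 2 * N) := by
    intro a₀ a₁
    have h := abs_qform_le_crossBound_of_sep hβ0.le (hψ.smul a₁) (hD.smul a₀) (by positivity : (0 : ℝ) ≤ 2 * ρ) (hsep a₁ a₀)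
    rw [qform_smul_left, OffTube.qform_smul_right β a₀ hψ hD, SFCompression.l2_smul_smul, SFCompression.l2_smul_smul] at h
    have e : a₀ * a₁ * qform su2Rep β Ωin ψ = -(a₁ * (a₀ * qform su2Rep β ψ D)) := by rw [hXeq]; ring
    rw [e, abs_neg]
    have hDN' : l2 D D ≤ N := hlDD.trans (div_le_self hNpos.le hβ1)
    have hDN : cb * (a₀ * a₀ * l2 D D) ≤ cb * (a₀ ^ 2 * N) := by
      rw [← sq]; exact mul_le_mul_of_nonneg_left (mul_le_mul_of_nonneg_left hDN' (sq_nonneg _)) hcb0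
    have e1 : a₁ * a₁ * l2 ψ ψ = a₁ ^ 2 * l2 ψ ψ := by rw [← sq]
    rw [e1] at h
    linarith only [h, hDN]
  -- the family `(Ω_in, ψ)` is admissible for the door
  set F : Fin 2 → GaugeConfig 3 L SU2 → ℝ := ![Ωin, ψ] with hFdef
  have hFphys : ∀ i, IsPhys (F i) := by
    intro i; fin_cases i
    · exact hΩin
    · exact hψ
  have hFsupp : ∀ i U, F i U ≠ 0 → ∃ z : Fin 3 → Bool, orbitDist (TT.twist3 z U) < powScale (1 / 40) β := by
    intro i U hU; fin_cases i
    · obtain ⟨z, hz⟩ := hΩinsupp U hU; exact ⟨z, hz.trans_le h6ρ⟩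
    · obtain ⟨z, hz⟩ := hψρ U hU; exact ⟨z, hz.trans_le hp40⟩
  have hn₀pos : 0 < l2 Ωin Ωin := by
    have : 2 * (N / β) < N := by
      have hL6 : (1 : ℝ) ≤ (L : ℝ) ^ 6 := one_le_pow₀ (by linarith only [hL0, show (1 : ℝ) ≤ L from by exact_mod_cast NeZero.one_le])
      have hβ4 : (4 : ℝ) ≤ β := by linarith only [hβL, hL6]
      rw [← sub_pos]
      have e : N - 2 * (N / β) = N * (β - 2) / β := by field_simp
      rw [e]; exact div_pos (mul_pos hNpos (by linarith only [hβ4])) hβ0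
    linarith only [hnge, this]
  have hcomb : ∀ a : Fin 2 → ℝ, (fun U => ∑ i, a i * F i U) = a 0 • Ωin + a 1 • ψ := fun a => comb_two_eq Ωin ψ a
  have hGram : ∀ a : Fin 2 → ℝ, a ≠ 0 → 0 < l2 (fun U => ∑ i, a i * F i U) (fun U => ∑ i, a i * F i U) := by
    intro a ha
    rw [hcomb a, l2_comb_two (a 0) (a 1) hΩin hψ, hlΩinψ, mul_zero, add_zero]
    have hor : a 0 ≠ 0 ∨ a 1 ≠ 0 := by
      by_contra h
      push Not at h
      exact ha (funext fun i => by fin_cases i <;> simp [h.1, h.2])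
    rcases hor with h0 | h1
    · have h2 := mul_pos (pow_pos (abs_pos.2 h0) 2) hn₀pos
      rw [sq_abs] at h2
      have h3 := mul_nonneg (sq_nonneg (a 1)) hnpos.le
      linarith only [h2, h3]
    · have h2 := mul_pos (pow_pos (abs_pos.2 h1) 2) hnpos
      rw [sq_abs] at h2
      have h3 := mul_nonneg (sq_nonneg (a 0)) hn₀pos.le
      linarith only [h2, h3]
  -- the door
  obtain ⟨a, ha, hdoor⟩ := hI' β hβI F hFphys hFsupp hGram
  rw [hcomb a, qform_comb_two β (a 0) (a 1) hΩin hψ, l2_comb_two (a 0) (a 1) hΩin hψ, hlΩinψ, mul_zero, add_zero,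
    levelValue_zero su2Rep L β] at hdoor
  have hor : a 0 ≠ 0 ∨ a 1 ≠ 0 := by
    by_contra h
    push Not at h
    exact ha (funext fun i => by fin_cases i <;> simp [h.1, h.2])
  -- normalise the door inequality by `μ₀`
  have hdoor' : a 0 ^ 2 * qform su2Rep β Ωin Ωin + 2 * (a 0 * a 1) * qform su2Rep β Ωin ψ + a 1 ^ 2 * qform su2Rep β ψ ψ ≤
      E * (a 0 ^ 2 * l2 Ωin Ωin + a 1 ^ 2 * l2 ψ ψ) := by
    rw [hEdef]
    rw [show Real.exp (C * u ^ 2) * μ1 * lam / μ0 * (a 0 ^ 2 * l2 Ωin Ωin + a 1 ^ 2 * l2 ψ ψ)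
        = Real.exp (C * u ^ 2) * μ1 * lam * (a 0 ^ 2 * l2 Ωin Ωin + a 1 ^ 2 * l2 ψ ψ) / μ0 by ring]
    rw [le_div_iff₀ hμ0]
    exact hdoor
  -- the quadratic endgame
  have hQψ : qform su2Rep β ψ ψ ≤ lam * l2 ψ ψ := qform_le_topValue_mul_l2 hβ0.le hψ
  have hQ₀ : (1 - 2 * (1 / β)) * lam * N ≤ qform su2Rep β Ωin Ωin := by
    have e : (1 - 2 * (1 / β)) * lam * N = lam * N - 2 * lam * (N / β) := by ring
    rw [e]
    exact hQ0
  have hn₀N : l2 Ωin Ωin ≤ N := hnle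
  have hfin := quad_endgame (Q := qform su2Rep β ψ ψ) (Q₀ := qform su2Rep β Ωin Ωin) (X := qform su2Rep β Ωin ψ)
    (n := l2 ψ ψ) (n₀ := l2 Ωin Ωin) (N := N) (E := E) (m := 1 / β) (a₀ := a 0) (a₁ := a 1)
    hlam0 hNpos hnpos.le hu0 hu1 hm hcb0 hcb hE hQψ hQ₀ (l2_self_nonneg _) hn₀N (hX (a 0) (a 1)) hor hdoor'
  -- conversion of the constant: `(C+1)·u² = ((C+1)/L)·λ_b²/L`, `E μ₀ = e^{Cu²} μ₁ λ₀`
  have hconv : Real.exp (u ^ 2) * E * μ0 = Real.exp ((C + 1) / L * bareLambda β ^ 2 / L) * μ1 * lam := by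
    have e1 : (C + 1) / L * bareLambda β ^ 2 / L = u ^ 2 + C * u ^ 2 := by rw [huL]; field_simp; ring
    rw [e1, Real.exp_add, hEdef]
    field_simp
  calc qform su2Rep β ψ ψ * μ0 ≤ (Real.exp (u ^ 2) * E * l2 ψ ψ) * μ0 := mul_le_mul_of_nonneg_right hfin hμ0.le
    _ = (Real.exp (u ^ 2) * E * μ0) * l2 ψ ψ := by ring
    _ = Real.exp ((C + 1) / L * bareLambda β ^ 2 / L) * μ1 * lam * l2 ψ ψ := by rw [hconv]

end GroundConc

end Summit.QuantumFields.YangMills.Theorems.FemtoTransferGap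

end
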